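import Summits.QuantumFields.YangMills.Theorems.U1DipoleHelicityOptimalTestForm
import Literature.MathematicalPhysics.QuantumFieldTheory.AbelianTorusCochains
import HarnessLib

/-!
# Route `TransverseWardBL`, support `BoxHodgeSplit` (stmt-QuantumFields-22932) — toolkit: the codifferential in coordinates

Route-independent lattice calculus on the 2-cochains `η : Plaquette 4 L → ℝ` of the four-torus `(ℤ/L)⁴` feeding the exact
Hodge split of the box form (file `TransverseWardBLBoxHodgeSplit.lean`):

* §1 sums over plaquettes plane by plane (`sum_mul_eq_sum_planes`);
* §2 **the codifferential in coordinates**: the pairing `∑_p η_p (dδ_{(x,a)})_p` of a 2-cochain with the coboundary of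
  the edge indicator `δ_{(x,a)}` is the lattice divergence `∑_{j ≠ a} (η_{aj}(x) − η_{aj}(x − e_j))` (`codiff`);
* §3 **co-closedness of the Hodge remainder**: for any `g, c` with the Poisson equation `(−Δ)g = c − C`, the 2-cochain
  `u = h_c − dψ_g` — `h_c` the `(0,1)`-form with site weights `c`, `ψ_g = d*(g ⊗ e₀∧e₁)` the tree's `testForm g` — is
  orthogonal to every `dδ_e` (`coclosed_boxRemainder`): four finite-difference identities on the abelian group `(ℤ/L)⁴`;
* §4 the norm bookkeeping `|dψ|² = ⟨dψ, h⟩`, `|u|² = |h|² − ⟨dψ, h⟩` for `u = h − dψ ⟂ dψ`.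

Free-hands width seat `ym-t4-w11` (cell ym-fleet) for planner ym-idea-4 g9 (LINE g9-A).  Elementary cochain algebra; nothing about
the Yang–Mills mass gap is proved.

References: J. Fröhlich, T. Spencer, Comm. Math. Phys. **83** (1982) 411, §2 (lattice Hodge decomposition) [FrohlichSpencer1982].
-/

set_option autoImplicit false

noncomputable section

open Finset
open scoped BigOperators
open Literature.MathematicalPhysics.QuantumFieldTheory Literature.MathematicalPhysics.QuantumLattice
open Summit.QuantumFields.YangMills.Theorems.U1DipoleHelicity

namespace Summit.QuantumFields.YangMills.Theorems.TransverseWardBL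

variable {L : ℕ} [NeZero L]

/-! ## §1 Sums over plaquettes, plane by plane -/

/-- A sum over the plaquettes of the four-torus, split over the six coordinate planes. [folklore] -/
theorem sum_plaquette_eq_sum_planes (F : Site 4 L → Fin 4 → Fin 4 → ℝ) :
    ∑ p : Plaquette 4 L, F p.1 p.2.1.1 p.2.1.2 =
      ∑ y : Site 4 L, (F y 0 1 + F y 0 2 + F y 0 3 + F y 1 2 + F y 1 3 + F y 2 3) := by
  rw [Fintype.sum_prod_type]
  exact Finset.sum_congr rfl fun y _ => sum_planes (F y)

/-- The pairing of two 2-cochains, plane by plane, through their alternating extensions `LatticeForm.ext`. [folklore] -/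
theorem sum_mul_eq_sum_planes (η ζ : Plaquette 4 L → ℝ) :
    ∑ p : Plaquette 4 L, η p * ζ p =
      ∑ y : Site 4 L, (LatticeForm.ext η y 0 1 * LatticeForm.ext ζ y 0 1 + LatticeForm.ext η y 0 2 * LatticeForm.ext ζ y 0 2 +
        LatticeForm.ext η y 0 3 * LatticeForm.ext ζ y 0 3 + LatticeForm.ext η y 1 2 * LatticeForm.ext ζ y 1 2 +
        LatticeForm.ext η y 1 3 * LatticeForm.ext ζ y 1 3 + LatticeForm.ext η y 2 3 * LatticeForm.ext ζ y 2 3) := by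
  have h : ∀ p : Plaquette 4 L, η p * ζ p =
      (fun (y : Site 4 L) (i j : Fin 4) => LatticeForm.ext η y i j * LatticeForm.ext ζ y i j) p.1 p.2.1.1 p.2.1.2 := by
    rintro ⟨y, ⟨⟨i, j⟩, hij⟩⟩
    simp only [LatticeForm.ext_apply_of_lt _ _ hij]
  rw [Finset.sum_congr rfl fun p _ => h p]
  exact sum_plaquette_eq_sum_planes (fun (y : Site 4 L) (i j : Fin 4) => LatticeForm.ext η y i j * LatticeForm.ext ζ y i j)

/-! ## §2 The codifferential in coordinates -/

/-- `∑_y F(y)·[y = x] = F(x)`. [folklore] -/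
theorem sum_mul_ite_eq_apply (F : Site 4 L → ℝ) (x : Site 4 L) :
    ∑ y : Site 4 L, F y * (if y = x then (1 : ℝ) else 0) = F x := by
  simp_rw [mul_ite, mul_one, mul_zero]
  rw [Finset.sum_ite_eq' Finset.univ x, if_pos (Finset.mem_univ _)]

/-- `∑_y F(y)·[y + v = x] = F(x − v)`. [folklore] -/
theorem sum_mul_ite_add_eq_apply (F : Site 4 L → ℝ) (x v : Site 4 L) :
    ∑ y : Site 4 L, F y * (if y + v = x then (1 : ℝ) else 0) = F (x - v) := by
  have h : ∀ y : Site 4 L, (y + v = x) ↔ (y = x - v) := fun y => eq_sub_iff_add_eq.symm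
  simp_rw [h]
  exact sum_mul_ite_eq_apply F (x - v)

/-- **One plane of the codifferential.** For a site function `F` (the `(i,j)` component of a 2-cochain) and the edge
indicator `δ_{(x,a)}`: `∑_y F(y)·(dδ_{(x,a)})(y;i,j) = [i = a](F(x) − F(x − e_j)) + [j = a](F(x − e_i) − F(x))`. [folklore] -/
theorem plane_codiff (F : Site 4 L → ℝ) (i j a : Fin 4) (x : Site 4 L) :
    ∑ y : Site 4 L, F y *
        LatticeForm.td₁ (fun (z : Site 4 L) (k : Fin 4) => if z = x ∧ k = a then (1 : ℝ) else 0) y i j =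
      (if i = a then F x - F (x - Pi.single j 1) else 0) +
        (if j = a then F (x - Pi.single i 1) - F x else 0) := by
  classical
  have hδ : ∀ (z : Site 4 L) (k : Fin 4), (if z = x ∧ k = a then (1 : ℝ) else 0) =
      (if k = a then (1 : ℝ) else 0) * (if z = x then 1 else 0) := by
    intro z k
    by_cases hz : z = x <;> by_cases hk : k = a <;> simp [hz, hk]
  simp only [LatticeForm.td₁, LatticeForm.te, hδ, mul_add, mul_sub, Finset.sum_add_distrib, Finset.sum_sub_distrib,
    mul_left_comm (F _), ← Finset.mul_sum, sum_mul_ite_eq_apply, sum_mul_ite_add_eq_apply]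
  split_ifs <;> ring

/-- **The codifferential in coordinates.** For a 2-cochain `η` on the genuine plaquettes of the four-torus (components
`η_{ij} = LatticeForm.ext η · i j`) and an edge `(x, a)`:
`∑_p η_p (dδ_{(x,a)})_p = ∑_{i<j} ([i = a](η_{ij}(x) − η_{ij}(x − e_j)) + [j = a](η_{ij}(x − e_i) − η_{ij}(x)))`. [folklore] -/
theorem codiff (η : Plaquette 4 L → ℝ) (x : Site 4 L) (a : Fin 4) :
    ∑ p : Plaquette 4 L, η p *
        LatticeForm.res (LatticeForm.td₁ (fun (z : Site 4 L) (k : Fin 4) => if z = x ∧ k = a then (1 : ℝ) else 0)) p =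
      ((if (0 : Fin 4) = a then LatticeForm.ext η x 0 1 - LatticeForm.ext η (x - Pi.single 1 1) 0 1 else 0) +
        (if (1 : Fin 4) = a then LatticeForm.ext η (x - Pi.single 0 1) 0 1 - LatticeForm.ext η x 0 1 else 0)) +
      ((if (0 : Fin 4) = a then LatticeForm.ext η x 0 2 - LatticeForm.ext η (x - Pi.single 2 1) 0 2 else 0) +
        (if (2 : Fin 4) = a then LatticeForm.ext η (x - Pi.single 0 1) 0 2 - LatticeForm.ext η x 0 2 else 0)) +
      ((if (0 : Fin 4) = a then LatticeForm.ext η x 0 3 - LatticeForm.ext η (x - Pi.single 3 1) 0 3 else 0) +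
        (if (3 : Fin 4) = a then LatticeForm.ext η (x - Pi.single 0 1) 0 3 - LatticeForm.ext η x 0 3 else 0)) +
      ((if (1 : Fin 4) = a then LatticeForm.ext η x 1 2 - LatticeForm.ext η (x - Pi.single 2 1) 1 2 else 0) +
        (if (2 : Fin 4) = a then LatticeForm.ext η (x - Pi.single 1 1) 1 2 - LatticeForm.ext η x 1 2 else 0)) +
      ((if (1 : Fin 4) = a then LatticeForm.ext η x 1 3 - LatticeForm.ext η (x - Pi.single 3 1) 1 3 else 0) +
        (if (3 : Fin 4) = a then LatticeForm.ext η (x - Pi.single 1 1) 1 3 - LatticeForm.ext η x 1 3 else 0)) +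
      ((if (2 : Fin 4) = a then LatticeForm.ext η x 2 3 - LatticeForm.ext η (x - Pi.single 3 1) 2 3 else 0) +
        (if (3 : Fin 4) = a then LatticeForm.ext η (x - Pi.single 2 1) 2 3 - LatticeForm.ext η x 2 3 else 0)) := by
  rw [sum_mul_eq_sum_planes,
    LatticeForm.ext_res (LatticeForm.isAlt_td₁ (fun (z : Site 4 L) (k : Fin 4) => if z = x ∧ k = a then (1 : ℝ) else 0))]
  simp only [Finset.sum_add_distrib, plane_codiff]

/-! ## §3 Co-closedness of the Hodge remainder `u = h_c − dψ_g` -/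

omit [NeZero L] in
/-- Components of the box-type form `h_c(p) = [p ∥ (0,1)]·c(p.1)`: the `(0,1)` component is `c`. [folklore] -/
theorem ext_boxForm_zero_one (c : Site 4 L → ℝ) (η : Plaquette 4 L → ℝ) (y : Site 4 L) :
    LatticeForm.ext (fun p : Plaquette 4 L => (if p.2.1 = ((0 : Fin 4), (1 : Fin 4)) then c p.1 else 0) - η p) y 0 1 =
      c y - LatticeForm.ext η y 0 1 := by
  rw [LatticeForm.ext_apply_of_lt _ _ (show (0 : Fin 4) < 1 by decide),
    LatticeForm.ext_apply_of_lt _ _ (show (0 : Fin 4) < 1 by decide)]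
  simp

omit [NeZero L] in
/-- Components of `h_c − η` off the `(0,1)` plane are `−η_{ij}`. [folklore] -/
theorem ext_boxForm_of_ne (c : Site 4 L → ℝ) (η : Plaquette 4 L → ℝ) (y : Site 4 L) {i j : Fin 4} (hij : i < j)
    (hne : (i, j) ≠ ((0 : Fin 4), (1 : Fin 4))) :
    LatticeForm.ext (fun p : Plaquette 4 L => (if p.2.1 = ((0 : Fin 4), (1 : Fin 4)) then c p.1 else 0) - η p) y i j =
      - LatticeForm.ext η y i j := by
  rw [LatticeForm.ext_apply_of_lt _ _ hij, LatticeForm.ext_apply_of_lt _ _ hij]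
  simp [hne]

omit [NeZero L] in
/-- Components of the coboundary `dψ_g` of the tree's test form: `LatticeForm.ext` of `p ↦ rplaqCharge (testForm g) p`
is `rplaqCharge (testForm g)`. [folklore] -/
theorem ext_rplaqCharge_testForm (g : Site 4 L → ℝ) (y : Site 4 L) {i j : Fin 4} (hij : i < j) :
    LatticeForm.ext (fun p : Plaquette 4 L => rplaqCharge (testForm g) p.1 p.2.1.1 p.2.1.2) y i j =
      rplaqCharge (testForm g) y i j :=
  LatticeForm.ext_apply_of_lt _ _ hij

/-- **Co-closedness of the Hodge remainder.**  Let `g, c : (ℤ/L)⁴ → ℝ` satisfy the Poisson equation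
`∑_μ (2g(y) − g(y+e_μ) − g(y−e_μ)) = c(y) − C` for all `y`.  Then the 2-cochain `u = h_c − dψ_g` (`h_c` the `(0,1)`-form
with weights `c`, `ψ_g = testForm g = d*(g ⊗ e₀∧e₁)`) is orthogonal to the coboundary of every edge indicator:
`∑_p u_p (dδ_e)_p = 0` — i.e. `d*u = 0`: `d*dψ_g = d*((−Δ g) ⊗ e₀∧e₁) = d*h_c` since `d*` kills constant forms.
[cite: FrohlichSpencer1982, §2] -/
theorem coclosed_boxRemainder (g c : Site 4 L → ℝ) (C : ℝ)
    (hP : ∀ y : Site 4 L, ∑ μ : Fin 4, (2 * g y - g (y + Pi.single μ 1) - g (y - Pi.single μ 1)) = c y - C)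
    (e : Edge 4 L) :
    ∑ p : Plaquette 4 L,
      ((if p.2.1 = ((0 : Fin 4), (1 : Fin 4)) then c p.1 else 0) - rplaqCharge (testForm g) p.1 p.2.1.1 p.2.1.2) *
        LatticeForm.res (LatticeForm.td₁ (fun (y : Site 4 L) (k : Fin 4) => if y = e.1 ∧ k = e.2 then (1 : ℝ) else 0)) p = 0 := by
  obtain ⟨x, a⟩ := e
  rw [codiff]
  simp only [ext_boxForm_zero_one,
    ext_boxForm_of_ne c _ _ (show (0 : Fin 4) < 2 by decide) (by decide),
    ext_boxForm_of_ne c _ _ (show (0 : Fin 4) < 3 by decide) (by decide),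
    ext_boxForm_of_ne c _ _ (show (1 : Fin 4) < 2 by decide) (by decide),
    ext_boxForm_of_ne c _ _ (show (1 : Fin 4) < 3 by decide) (by decide),
    ext_boxForm_of_ne c _ _ (show (2 : Fin 4) < 3 by decide) (by decide),
    ext_rplaqCharge_testForm g _ (show (0 : Fin 4) < 1 by decide),
    ext_rplaqCharge_testForm g _ (show (0 : Fin 4) < 2 by decide),
    ext_rplaqCharge_testForm g _ (show (0 : Fin 4) < 3 by decide),
    ext_rplaqCharge_testForm g _ (show (1 : Fin 4) < 2 by decide),
    ext_rplaqCharge_testForm g _ (show (1 : Fin 4) < 3 by decide),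
    ext_rplaqCharge_testForm g _ (show (2 : Fin 4) < 3 by decide),
    rplaqCharge_testForm_zero_one, rplaqCharge_testForm_two_three,
    rplaqCharge_testForm_zero_of_two_le g _ (show (2 : Fin 4) ≠ 0 by decide) (show (2 : Fin 4) ≠ 1 by decide),
    rplaqCharge_testForm_zero_of_two_le g _ (show (3 : Fin 4) ≠ 0 by decide) (show (3 : Fin 4) ≠ 1 by decide),
    rplaqCharge_testForm_one_of_two_le g _ (show (2 : Fin 4) ≠ 0 by decide) (show (2 : Fin 4) ≠ 1 by decide),
    rplaqCharge_testForm_one_of_two_le g _ (show (3 : Fin 4) ≠ 0 by decide) (show (3 : Fin 4) ≠ 1 by decide)]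
  fin_cases a
  · -- a = 0: d*u(x,0) = (c(x) − c(x−e₁)) − ∇₁⁻(−Δ g)(x) = 0 by the Poisson equation at x and x − e₁
    have h1 := hP x
    have h2 := hP (x - Pi.single 1 1)
    simp only [Fin.sum_univ_four] at h1 h2
    simp (decide := true) only [Fin.isValue, reduceIte]
    simp only [sub_add_cancel, add_sub_right_comm, sub_right_comm x (Pi.single 2 1) (Pi.single 1 1),
      sub_right_comm x (Pi.single 3 1) (Pi.single 1 1)] at h2 ⊢
    linear_combination h2 - h1
  · -- a = 1: d*u(x,1) = −(c(x) − c(x−e₀)) + ∇₀⁻(−Δ g)(x) = 0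
    have h1 := hP x
    have h2 := hP (x - Pi.single 0 1)
    simp only [Fin.sum_univ_four] at h1 h2
    simp (decide := true) only [Fin.isValue, reduceIte]
    simp only [sub_add_cancel, add_sub_right_comm, sub_right_comm x (Pi.single 2 1) (Pi.single 0 1),
      sub_right_comm x (Pi.single 3 1) (Pi.single 0 1)] at h2 ⊢
    linear_combination h1 - h2
  · -- a = 2: commuting differences
    simp (decide := true) only [Fin.isValue, reduceIte]
    simp only [add_sub_right_comm, sub_right_comm x (Pi.single 1 1) (Pi.single 0 1)]
    ring
  · -- a = 3: commuting differences
    simp (decide := true) only [Fin.isValue, reduceIte]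
    simp only [add_sub_right_comm, sub_right_comm x (Pi.single 1 1) (Pi.single 0 1)]
    ring

/-! ## §4 Norm bookkeeping for an orthogonal split -/

/-- Pairing with the box-type form picks the `(0,1)` components: `∑_p h_c(p) ζ(p) = ∑_y c(y) ζ_{01}(y)`. [folklore] -/
theorem sum_boxForm_mul (c : Site 4 L → ℝ) (ζ : Plaquette 4 L → ℝ) :
    ∑ p : Plaquette 4 L, (if p.2.1 = ((0 : Fin 4), (1 : Fin 4)) then c p.1 else 0) * ζ p =
      ∑ y : Site 4 L, c y * LatticeForm.ext ζ y 0 1 := by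
  rw [sum_mul_eq_sum_planes]
  refine Finset.sum_congr rfl fun y _ => ?_
  rw [LatticeForm.ext_apply_of_lt _ _ (show (0 : Fin 4) < 1 by decide),
    LatticeForm.ext_apply_of_lt _ _ (show (0 : Fin 4) < 2 by decide),
    LatticeForm.ext_apply_of_lt _ _ (show (0 : Fin 4) < 3 by decide),
    LatticeForm.ext_apply_of_lt _ _ (show (1 : Fin 4) < 2 by decide),
    LatticeForm.ext_apply_of_lt _ _ (show (1 : Fin 4) < 3 by decide),
    LatticeForm.ext_apply_of_lt _ _ (show (2 : Fin 4) < 3 by decide)]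
  simp

/-- **Norms of an orthogonal split** `h = n + u` with `⟨u, n⟩ = 0`: `|n|² = ⟨n, h⟩` and `|u|² = |h|² − ⟨n, h⟩`. [folklore] -/
theorem norms_of_orthogonal_split {ι : Type*} [Fintype ι] (h n u : ι → ℝ) (hu : ∀ p, u p = h p - n p)
    (horth : ∑ p, u p * n p = 0) :
    (∑ p, n p ^ 2 = ∑ p, n p * h p) ∧ (∑ p, u p ^ 2 = ∑ p, h p ^ 2 - ∑ p, n p * h p) := by
  have h1 : ∑ p, n p ^ 2 = ∑ p, n p * h p - ∑ p, u p * n p := by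
    rw [← Finset.sum_sub_distrib]
    exact Finset.sum_congr rfl fun p _ => by rw [hu]; ring
  have h2 : ∑ p, u p ^ 2 = ∑ p, h p ^ 2 - ∑ p, n p * h p - ∑ p, u p * n p := by
    rw [← Finset.sum_sub_distrib, ← Finset.sum_sub_distrib]
    exact Finset.sum_congr rfl fun p _ => by rw [hu]; ring
  rw [h1, h2, horth, sub_zero, sub_zero]
  exact ⟨rfl, rfl⟩

end Summit.QuantumFields.YangMills.Theorems.TransverseWardBL

end
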